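import Mathlib.Data.Real.Basic
import Mathlib.Tactic.Positivity
import Mathlib.Tactic.Ring
import Mathlib.Tactic.Linarith
import HarnessLib

/-!
# R1 for the random-cluster measure on hub-apex wheels and fans: the side-summary certificate

Support file for `stmt-CriticalPhenomena-4575` (memo `prim-gen-kcluster/KCLUSTER-gen69.md`, unit
prim-gen-kcluster, gen 69).  Pure real algebra — no definitions, no sorries; the probabilistic
      quantities
enter as real variables together with the single-side inequalities they satisfy.

**Setting (memo §1–§3).**  `G` = hub `a` + rim (a cycle for the wheel `W_n`, a path for the fan)
      with
arbitrary edge parameters in `[0,1)`, random-cluster weights `p^ω (1-p)^{1-ω} q^{k(ω)}`, `q ≥ 1`;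
      the
refined row R1 at apex `a` with rim terminals `b, c` is `t·s_a ≤ u_b·u_c` (`t = φ(b,c ∈ C_a)`,
`u_b = φ(b ∈ C_a, c ∉ C_a)`, `u_c` symmetrically, `s_a = φ(b,c ∉ C_a, V(C_a) separates b from c)`;
at `q = 1` it is the tree's `RefinedRowR1.r1_PrW` = dual BHK).  Removing `b` and `c` cuts the rim
      into
(at most) two SIDES; a side is a path `v_1 … v_L` of interior rim vertices with its rim edges
`e_0 = b v_1, …, e_L = v_L c` and spokes.  The hub factorisation makes the two sides independent,
      and
R1 depends on a side only through TEN summary weights: `n` / `t` = all rim edges of the side open,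
without / with an open interior spoke ("through" states), and, when some rim edge of the side is
      closed,
the weights `w(x_b, x_c, z)` where `x_b` = "the open run from `b` into the side carries an open
      spoke",
`x_c` likewise from `c`, `z` = "some middle arc (an open run touching neither end) carries an open
spoke", each middle arc without spoke weighted by `q` (it is a separate cluster).  Merging the
      `z`-flag
where it is not needed: `e = w(0,0,0)`, `s = w(0,0,1)` (= σ), `b = w(1,0,·)`, `g = w(0,1,·)`,
`d = w(1,1,·)`; `a = e + s`, `N = a+b+g+d`, `M = N+n+t`.  With terminal spoke parameters `x =
      p_{ab}`,
`y = p_{ac}` the four R1 quantities of the wheel are (common factor `q²(1-x)(1-y)/Z²` dropped; memo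
      §2,
validated against brute force): `S = s_A s_B`, `U_b U_c = P·Q`, `T = T_SP + T_TH` as displayed in
`wheel_certificate`.  So R1 on the wheel is `s_A s_B (T_SP + T_TH) ≤ P Q`.

**Single-side facts (memo §4, proved there for every side path and every `q ≥ 1`).**
(M2) `s·(t + d) ≤ b·g` — this IS R1 for the fan over the side with pendant terminals, proved by
induction on `L` using `fan_certificate`; (LB) `s·n ≤ e·b` and (LG) `s·n ≤ e·g` —
      weight-non-decreasing
injections (open the last / first closed rim edge of the σ-configuration, close it in the through
      one).

**Results (all by `ring` / `linarith`; certificate found by LP, kit j210488, verified in exact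
arithmetic).** `side_identity`: `P Q − a_A a_B T_SP = a_A N_A Δ_B + a_B N_B Δ_A + Δ_A Δ_B`,
`Δ = b g − a d`.  `i11_of_m2_lb`: `s·M ≤ (a+b)(a+g)`.  `fan_certificate`: the one-side inequality
`s (d + b y + g x + a x y + t + n (x+y−xy)) ≤ (b + x a)(g + y a)` for `x, y ∈ [0,1]` (R1 on the fan
with end terminals, given (M2),(LB),(LG) for its inner side).  `wheel_corner00/10/01/11` and
`wheel_certificate`: `s_A s_B (T_SP + T_TH) ≤ P Q` for all `x, y ∈ [0,1]`, given (M2),(LB),(LG) for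
both sides — R1 for `φ_{p,q}`, `q ≥ 1`, on every hub-apex wheel (the first family beyond
series-parallel and planar-cofacial graphs) and, more generally, whenever every component of `G −
      a` is
a path or a cycle. [this work]
-/

namespace Summit.CriticalPhenomena.PercolationContinuityZ3.Theorems

namespace WheelR1

/-- **Side identity.** With `Δ = b g − a d` per side,
`P·Q − a_A a_B·T_SP = a_A N_A Δ_B + a_B N_B Δ_A + Δ_A Δ_B` for all values of the terminal spoke
parameters `x, y` (the `x,y`-dependence cancels). [this work] -/
theorem side_identity (eA sA bA gA dA eB sB bB gB dB : ℝ) (x y : ℝ) :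
    (x * (eA + sA) * (eB + sB) + (eA + sA) * bB + bA * (eB + sB) + bA * bB) * (y * (eA + sA) * (eB
          + sB) + (eA + sA) * gB + gA * (eB + sB) + gA * gB)
      - (eA + sA) * (eB + sB) * ((eA + sA) * ((eB + sB) * x * y + bB * y + gB * x + dB) + bA * ((eB
            + sB) * y + bB * y + gB + dB) + gA * ((eB + sB) * x + bB + gB * x + dB) + dA * (eB + sB
            + bB + gB + dB))
    = (eA + sA) * (eA + sA + bA + gA + dA) * (bB * gB - (eB + sB) * dB)
      + (eB + sB) * (eB + sB + bB + gB + dB) * (bA * gA - (eA + sA) * dA)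
      + (bA * gA - (eA + sA) * dA) * (bB * gB - (eB + sB) * dB) := by
  ring

/-- (I11) from (M2) and (LB): `s·M ≤ (a+b)(a+g)` for one side. [this work] -/
theorem i11_of_m2_lb (eA sA bA gA dA nA tA : ℝ) (heA : 0 ≤ eA) (hsA : 0 ≤ sA) (hgA : 0 ≤ gA)
    (hMA : sA * (tA + dA) ≤ bA * gA) (hBA : sA * nA ≤ eA * bA) :
    sA * (eA + sA + bA + gA + dA + nA + tA) ≤ (eA + sA + bA) * (eA + sA + gA) := by
  nlinarith [mul_nonneg heA (by linarith : (0:ℝ) ≤ eA + sA + gA)]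

/-- **Fan certificate (one side).**  For the fan `a + (b, v_1, …, v_L, c)` with hub apex `a`,
end terminals `b, c` with spoke parameters `x, y ∈ [0,1]`, and inner side `v_1 … v_L` (summary
      weights
`e,s,b,g,d,n,t`), R1 reads `s·(d + b y + g x + a x y + t + n(x+y−xy)) ≤ (b + x a)(g + y a)`; it is
multi-affine in `(x,y)` with corner values (M2), (M2)+(LG), (M2)+(LB), (I11), hence follows from
      (M2),
(LB), (LG) for the inner side. [this work] -/
theorem fan_certificate (eA sA bA gA dA nA tA x y : ℝ) (heA : 0 ≤ eA) (hsA : 0 ≤ sA) (hgA : 0 ≤ gA)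
    (hx0 : 0 ≤ x) (hx1 : x ≤ 1) (hy0 : 0 ≤ y) (hy1 : y ≤ 1)
    (hMA : sA * (tA + dA) ≤ bA * gA) (hBA : sA * nA ≤ eA * bA) (hGA : sA * nA ≤ eA * gA) :
    sA * (dA + bA * y + gA * x + (eA + sA) * x * y + tA + nA * (x + y - x * y))
      ≤ (bA + x * (eA + sA)) * (gA + y * (eA + sA)) := by
  have hI : sA * (eA + sA + bA + gA + dA + nA + tA) ≤ (eA + sA + bA) * (eA + sA + gA) :=
    i11_of_m2_lb eA sA bA gA dA nA tA heA hsA hgA hMA hBA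
  have c00 : 0 ≤ bA * gA - sA * (tA + dA) := sub_nonneg.mpr hMA
  have c10 : 0 ≤ (bA * gA - sA * (tA + dA)) + (eA * gA - sA * nA) := by linarith
  have c01 : 0 ≤ (bA * gA - sA * (tA + dA)) + (eA * bA - sA * nA) := by linarith
  have c11 : 0 ≤ (eA + sA + bA) * (eA + sA + gA) - sA * (eA + sA + bA + gA + dA + nA + tA) :=
        sub_nonneg.mpr hI
  have key : (bA + x * (eA + sA)) * (gA + y * (eA + sA))
      - sA * (dA + bA * y + gA * x + (eA + sA) * x * y + tA + nA * (x + y - x * y))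
      = (1 - x) * (1 - y) * (bA * gA - sA * (tA + dA))
        + x * (1 - y) * ((bA * gA - sA * (tA + dA)) + (eA * gA - sA * nA))
        + (1 - x) * y * ((bA * gA - sA * (tA + dA)) + (eA * bA - sA * nA))
        + x * y * ((eA + sA + bA) * (eA + sA + gA) - sA * (eA + sA + bA + gA + dA + nA + tA)) := by
              ring
  linarith [mul_nonneg (mul_nonneg (sub_nonneg.mpr hx1) (sub_nonneg.mpr hy1)) c00,
    mul_nonneg (mul_nonneg hx0 (sub_nonneg.mpr hy1)) c10,
    mul_nonneg (mul_nonneg (sub_nonneg.mpr hx1) hy0) c01,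
    mul_nonneg (mul_nonneg hx0 hy0) c11, key]

/-- Wheel certificate at the corner `(x,y) = (1,1)` of the terminal-spoke square: the slack is
an explicit non-negative combination of products of single-side slacks (LP certificate, kit j210488;
exact). [this work] -/
theorem wheel_corner11 (eA sA bA gA dA nA tA eB sB bB gB dB nB tB : ℝ)
    (heA : 0 ≤ eA) (hsA : 0 ≤ sA) (hbA : 0 ≤ bA) (hgA : 0 ≤ gA) (hdA : 0 ≤ dA) (hnA : 0 ≤ nA) (htA
          : 0 ≤ tA)
    (heB : 0 ≤ eB) (hsB : 0 ≤ sB) (hbB : 0 ≤ bB) (hgB : 0 ≤ gB) (hdB : 0 ≤ dB) (hnB : 0 ≤ nB) (htB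
          : 0 ≤ tB)
    (hMA : sA * (tA + dA) ≤ bA * gA) (hBA : sA * nA ≤ eA * bA)
    (hMB : sB * (tB + dB) ≤ bB * gB) (hBB : sB * nB ≤ eB * bB) :
    sA * sB * (((eA + sA) * ((eB + sB) * 1 * 1 + bB * 1 + gB * 1 + dB) + bA * ((eB + sB) * 1 + bB *
          1 + gB + dB) + gA * ((eB + sB) * 1 + bB + gB * 1 + dB) + dA * (eB + sB + bB + gB + dB)) +
          (tA * (eB + sB + bB + gB + dB + nB + tB) + nA * ((eB + sB + bB + gB + dB + nB + tB) - (1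
          - 1) * (1 - 1) * ((eB + sB) + nB)) + tB * (eA + sA + bA + gA + dA) + nB * ((eA + sA + bA
          + gA + dA) - (1 - 1) * (1 - 1) * (eA + sA))))
      ≤ (1 * (eA + sA) * (eB + sB) + (eA + sA) * bB + bA * (eB + sB) + bA * bB) * (1 * (eA + sA) *
            (eB + sB) + (eA + sA) * gB + gA * (eB + sB) + gA * gB) := by
  have hIA : sA * (eA + sA + bA + gA + dA + nA + tA) ≤ (eA + sA + bA) * (eA + sA + gA) :=
    i11_of_m2_lb eA sA bA gA dA nA tA heA hsA hgA hMA hBA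
  have hIB : sB * (eB + sB + bB + gB + dB + nB + tB) ≤ (eB + sB + bB) * (eB + sB + gB) :=
    i11_of_m2_lb eB sB bB gB dB nB tB heB hsB hgB hMB hBB
  have t1 : 0 ≤ ((eA + sA + bA) * (eA + sA + gA)) * ((eB + sB + bB) * (eB + sB + gB) - sB * (eB +
        sB + bB + gB + dB + nB + tB)) :=
    mul_nonneg (mul_nonneg (by linarith : (0:ℝ) ≤ (eA + sA + bA)) (by linarith : (0:ℝ) ≤ (eA + sA +
          gA))) (sub_nonneg.mpr hIB)
  have t2 : 0 ≤ ((eA + sA + bA) * (eA + sA + gA) - sA * (eA + sA + bA + gA + dA + nA + tA)) * ((eB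
        + sB + bB) * (eB + sB + gB)) :=
    mul_nonneg (sub_nonneg.mpr hIA) (mul_nonneg (by linarith : (0:ℝ) ≤ (eB + sB + bB)) (by linarith
          : (0:ℝ) ≤ (eB + sB + gB)))
  have t3 : 0 ≤ (sA * (eA + sA + bA + gA + dA + nA + tA)) * ((eB + sB + bB) * (eB + sB + gB) - sB *
        (eB + sB + bB + gB + dB + nB + tB)) :=
    mul_nonneg (mul_nonneg (by linarith : (0:ℝ) ≤ sA) (by linarith : (0:ℝ) ≤ (eA + sA + bA + gA +
          dA + nA + tA))) (sub_nonneg.mpr hIB)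
  have t4 : 0 ≤ ((eA + sA + bA) * (eA + sA + gA) - sA * (eA + sA + bA + gA + dA + nA + tA)) * (sB *
        (eB + sB + bB + gB + dB + nB + tB)) :=
    mul_nonneg (sub_nonneg.mpr hIA) (mul_nonneg (by linarith : (0:ℝ) ≤ sB) (by linarith : (0:ℝ) ≤
          (eB + sB + bB + gB + dB + nB + tB)))
  have key : (1 * (eA + sA) * (eB + sB) + (eA + sA) * bB + bA * (eB + sB) + bA * bB) * (1 * (eA +
        sA) * (eB + sB) + (eA + sA) * gB + gA * (eB + sB) + gA * gB) - sA * sB * (((eA + sA) * ((eB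
        + sB) * 1 * 1 + bB * 1 + gB * 1 + dB) + bA * ((eB + sB) * 1 + bB * 1 + gB + dB) + gA * ((eB
        + sB) * 1 + bB + gB * 1 + dB) + dA * (eB + sB + bB + gB + dB)) + (tA * (eB + sB + bB + gB +
        dB + nB + tB) + nA * ((eB + sB + bB + gB + dB + nB + tB) - (1 - 1) * (1 - 1) * ((eB + sB) +
        nB)) + tB * (eA + sA + bA + gA + dA) + nB * ((eA + sA + bA + gA + dA) - (1 - 1) * (1 - 1) *
        (eA + sA))))
      = (1/2:ℝ) * (((eA + sA + bA) * (eA + sA + gA)) * ((eB + sB + bB) * (eB + sB + gB) - sB * (eB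
            + sB + bB + gB + dB + nB + tB))) + (1/2:ℝ) * (((eA + sA + bA) * (eA + sA + gA) - sA *
            (eA + sA + bA + gA + dA + nA + tA)) * ((eB + sB + bB) * (eB + sB + gB))) + (1/2:ℝ) *
            ((sA * (eA + sA + bA + gA + dA + nA + tA)) * ((eB + sB + bB) * (eB + sB + gB) - sB *
            (eB + sB + bB + gB + dB + nB + tB))) + (1/2:ℝ) * (((eA + sA + bA) * (eA + sA + gA) - sA
            * (eA + sA + bA + gA + dA + nA + tA)) * (sB * (eB + sB + bB + gB + dB + nB + tB))) :=
            by ring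
  linarith [t1, t2, t3, t4, key]

/-- Wheel certificate at the corner `(x,y) = (1,0)` of the terminal-spoke square: the slack is
an explicit non-negative combination of products of single-side slacks (LP certificate, kit j210488;
exact). [this work] -/
theorem wheel_corner10 (eA sA bA gA dA nA tA eB sB bB gB dB nB tB : ℝ)
    (heA : 0 ≤ eA) (hsA : 0 ≤ sA) (hbA : 0 ≤ bA) (hgA : 0 ≤ gA) (hdA : 0 ≤ dA) (hnA : 0 ≤ nA) (htA
          : 0 ≤ tA)
    (heB : 0 ≤ eB) (hsB : 0 ≤ sB) (hbB : 0 ≤ bB) (hgB : 0 ≤ gB) (hdB : 0 ≤ dB) (hnB : 0 ≤ nB) (htB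
          : 0 ≤ tB)
    (hMA : sA * (tA + dA) ≤ bA * gA) (hGA : sA * nA ≤ eA * gA)
    (hMB : sB * (tB + dB) ≤ bB * gB) (hGB : sB * nB ≤ eB * gB) :
    sA * sB * (((eA + sA) * ((eB + sB) * 1 * 0 + bB * 0 + gB * 1 + dB) + bA * ((eB + sB) * 0 + bB *
          0 + gB + dB) + gA * ((eB + sB) * 1 + bB + gB * 1 + dB) + dA * (eB + sB + bB + gB + dB)) +
          (tA * (eB + sB + bB + gB + dB + nB + tB) + nA * ((eB + sB + bB + gB + dB + nB + tB) - (1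
          - 1) * (1 - 0) * ((eB + sB) + nB)) + tB * (eA + sA + bA + gA + dA) + nB * ((eA + sA + bA
          + gA + dA) - (1 - 1) * (1 - 0) * (eA + sA))))
      ≤ (1 * (eA + sA) * (eB + sB) + (eA + sA) * bB + bA * (eB + sB) + bA * bB) * (0 * (eA + sA) *
            (eB + sB) + (eA + sA) * gB + gA * (eB + sB) + gA * gB) := by
  have t1 : 0 ≤ ((eA + sA + bA) * (eA + sA + gA)) * (bB * gB - sB * (tB + dB)) :=
    mul_nonneg (mul_nonneg (by linarith : (0:ℝ) ≤ (eA + sA + bA)) (by linarith : (0:ℝ) ≤ (eA + sA +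
          gA))) (sub_nonneg.mpr hMB)
  have t2 : 0 ≤ (bA * gA - sA * (tA + dA)) * ((eB + sB + bB) * (eB + sB + gB)) :=
    mul_nonneg (sub_nonneg.mpr hMA) (mul_nonneg (by linarith : (0:ℝ) ≤ (eB + sB + bB)) (by linarith
          : (0:ℝ) ≤ (eB + sB + gB)))
  have t3 : 0 ≤ ((eA + sA + bA) * (eA + sA + gA)) * (eB * gB - sB * nB) :=
    mul_nonneg (mul_nonneg (by linarith : (0:ℝ) ≤ (eA + sA + bA)) (by linarith : (0:ℝ) ≤ (eA + sA +
          gA))) (sub_nonneg.mpr hGB)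
  have t4 : 0 ≤ (eA * gA - sA * nA) * ((eB + sB + bB) * (eB + sB + gB)) :=
    mul_nonneg (sub_nonneg.mpr hGA) (mul_nonneg (by linarith : (0:ℝ) ≤ (eB + sB + bB)) (by linarith
          : (0:ℝ) ≤ (eB + sB + gB)))
  have t5 : 0 ≤ (sA * (eA + sA + bA + gA + dA + nA + tA)) * (bB * gB - sB * (tB + dB)) :=
    mul_nonneg (mul_nonneg (by linarith : (0:ℝ) ≤ sA) (by linarith : (0:ℝ) ≤ (eA + sA + bA + gA +
          dA + nA + tA))) (sub_nonneg.mpr hMB)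
  have t6 : 0 ≤ (bA * gA - sA * (tA + dA)) * (sB * (eB + sB + bB + gB + dB + nB + tB)) :=
    mul_nonneg (sub_nonneg.mpr hMA) (mul_nonneg (by linarith : (0:ℝ) ≤ sB) (by linarith : (0:ℝ) ≤
          (eB + sB + bB + gB + dB + nB + tB)))
  have t7 : 0 ≤ (sA * (eA + sA + bA + gA + dA + nA + tA)) * (eB * gB - sB * nB) :=
    mul_nonneg (mul_nonneg (by linarith : (0:ℝ) ≤ sA) (by linarith : (0:ℝ) ≤ (eA + sA + bA + gA +
          dA + nA + tA))) (sub_nonneg.mpr hGB)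
  have t8 : 0 ≤ (eA * gA - sA * nA) * (sB * (eB + sB + bB + gB + dB + nB + tB)) :=
    mul_nonneg (sub_nonneg.mpr hGA) (mul_nonneg (by linarith : (0:ℝ) ≤ sB) (by linarith : (0:ℝ) ≤
          (eB + sB + bB + gB + dB + nB + tB)))
  have t9 : 0 ≤ (eA * (eA + sA + bA)) * (gB * (eB + sB + bB)) :=
    mul_nonneg (mul_nonneg (by linarith : (0:ℝ) ≤ eA) (by linarith : (0:ℝ) ≤ (eA + sA + bA)))
          (mul_nonneg (by linarith : (0:ℝ) ≤ gB) (by linarith : (0:ℝ) ≤ (eB + sB + bB)))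
  have t10 : 0 ≤ (gA * (eA + sA + bA)) * (eB * (eB + sB + bB)) :=
    mul_nonneg (mul_nonneg (by linarith : (0:ℝ) ≤ gA) (by linarith : (0:ℝ) ≤ (eA + sA + bA)))
          (mul_nonneg (by linarith : (0:ℝ) ≤ eB) (by linarith : (0:ℝ) ≤ (eB + sB + bB)))
  have t11 : 0 ≤ (eA * (eA + sA + bA)) * (sB * (gB + dB)) :=
    mul_nonneg (mul_nonneg (by linarith : (0:ℝ) ≤ eA) (by linarith : (0:ℝ) ≤ (eA + sA + bA)))
          (mul_nonneg (by linarith : (0:ℝ) ≤ sB) (by linarith : (0:ℝ) ≤ (gB + dB)))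
  have t12 : 0 ≤ (sA * (gA + dA)) * (eB * (eB + sB + bB)) :=
    mul_nonneg (mul_nonneg (by linarith : (0:ℝ) ≤ sA) (by linarith : (0:ℝ) ≤ (gA + dA)))
          (mul_nonneg (by linarith : (0:ℝ) ≤ eB) (by linarith : (0:ℝ) ≤ (eB + sB + bB)))
  have t13 : 0 ≤ (eA * (eA + sA + bA)) * (sB * (nB + tB)) :=
    mul_nonneg (mul_nonneg (by linarith : (0:ℝ) ≤ eA) (by linarith : (0:ℝ) ≤ (eA + sA + bA)))
          (mul_nonneg (by linarith : (0:ℝ) ≤ sB) (by linarith : (0:ℝ) ≤ (nB + tB)))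
  have t14 : 0 ≤ (sA * (nA + tA)) * (eB * (eB + sB + bB)) :=
    mul_nonneg (mul_nonneg (by linarith : (0:ℝ) ≤ sA) (by linarith : (0:ℝ) ≤ (nA + tA)))
          (mul_nonneg (by linarith : (0:ℝ) ≤ eB) (by linarith : (0:ℝ) ≤ (eB + sB + bB)))
  have key : (1 * (eA + sA) * (eB + sB) + (eA + sA) * bB + bA * (eB + sB) + bA * bB) * (0 * (eA +
        sA) * (eB + sB) + (eA + sA) * gB + gA * (eB + sB) + gA * gB) - sA * sB * (((eA + sA) * ((eB
        + sB) * 1 * 0 + bB * 0 + gB * 1 + dB) + bA * ((eB + sB) * 0 + bB * 0 + gB + dB) + gA * ((eB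
        + sB) * 1 + bB + gB * 1 + dB) + dA * (eB + sB + bB + gB + dB)) + (tA * (eB + sB + bB + gB +
        dB + nB + tB) + nA * ((eB + sB + bB + gB + dB + nB + tB) - (1 - 1) * (1 - 0) * ((eB + sB) +
        nB)) + tB * (eA + sA + bA + gA + dA) + nB * ((eA + sA + bA + gA + dA) - (1 - 1) * (1 - 0) *
        (eA + sA))))
      = (1/2:ℝ) * (((eA + sA + bA) * (eA + sA + gA)) * (bB * gB - sB * (tB + dB))) + (1/2:ℝ) * ((bA
            * gA - sA * (tA + dA)) * ((eB + sB + bB) * (eB + sB + gB))) + (1/2:ℝ) * (((eA + sA +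
            bA) * (eA + sA + gA)) * (eB * gB - sB * nB)) + (1/2:ℝ) * ((eA * gA - sA * nA) * ((eB +
            sB + bB) * (eB + sB + gB))) + (1/2:ℝ) * ((sA * (eA + sA + bA + gA + dA + nA + tA)) *
            (bB * gB - sB * (tB + dB))) + (1/2:ℝ) * ((bA * gA - sA * (tA + dA)) * (sB * (eB + sB +
            bB + gB + dB + nB + tB))) + (1/2:ℝ) * ((sA * (eA + sA + bA + gA + dA + nA + tA)) * (eB
            * gB - sB * nB)) + (1/2:ℝ) * ((eA * gA - sA * nA) * (sB * (eB + sB + bB + gB + dB + nB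
            + tB))) + (1/2:ℝ) * ((eA * (eA + sA + bA)) * (gB * (eB + sB + bB))) + (1/2:ℝ) * ((gA *
            (eA + sA + bA)) * (eB * (eB + sB + bB))) + (1/2:ℝ) * ((eA * (eA + sA + bA)) * (sB * (gB
            + dB))) + (1/2:ℝ) * ((sA * (gA + dA)) * (eB * (eB + sB + bB))) + (1/2:ℝ) * ((eA * (eA +
            sA + bA)) * (sB * (nB + tB))) + (1/2:ℝ) * ((sA * (nA + tA)) * (eB * (eB + sB + bB))) :=
            by ring
  linarith [t1, t2, t3, t4, t5, t6, t7, t8, t9, t10, t11, t12, t13, t14, key]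

end WheelR1

end Summit.CriticalPhenomena.PercolationContinuityZ3.Theorems
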